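import Literature.NumberTheory.EllipticCurves.Kato2004.EulerSystemClassNonvanishingRohrlichProofs
import Literature.NumberTheory.EllipticCurves.Kato2004.EulerSystemBoundFineSelmerTwo
import Literature.NumberTheory.EllipticCurves.Kato2004.LayerCharacterTwoProofs
import Literature.NumberTheory.EllipticCurves.CyclotomicZpExtensionLayerTorsionTwoProofs
import Mathlib.NumberTheory.DirichletCharacter.Bounds
import Mathlib.RingTheory.RootsOfUnity.Complex
import HarnessLib

/-!
# Kato 2004 (Astérisque 295) at `p = 2`: the Λ-adic lift of Kato's zeta family in `𝐇¹_Γ(T₂W)` is NON-ZERO in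
# every analytic rank — Thm. 12.5 (1) ⇐ Rohrlich at `p = 2`; hypothesis (i) of Thm. 13.4 / (12.2.2)
# `rank_Λ 𝐇¹_Γ(T₂W) ≥ 1` for `W[2]` irreducible, modulo the ONE construction fact (THEOREMS ONLY; the `p = 2`
# twin of `ZetaBodyLayerValuesProofs` §3 + `EulerSystemClassNonvanishingRohrlichProofs`)

Topic `NumberTheory/EllipticCurves`, sub-directory `Kato2004` (namespace = path). THEOREMS ONLY (net debt 0): no
`def`, no named fact, no instance, no `sorry`. Cell `bsd-2adic`, seat `bsd-2adic-addL2x` (GEN 20; crux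
stmt-BirchSwinnertonDyer-19098 `AdditiveRankZeroAtTwo`, child C4″ stmt-BirchSwinnertonDyer-22618; road R-B83 (2)
«Kato Thm. 12.5 (1) for `z(f_W)` at `p = 2`»). HONEST FRAMING: BSD is not proved by any of this; nothing about
Kato's Main Conjecture is asserted; §3–§4 are CONDITIONAL on a `ZetaBody` witness resp. on the construction fact
`exists_eulerSystem_expStar_values` (def:Prop, no `_holds`), and take Rohrlich's finiteness as a displayed hypothesis
`hR` in the EXACT shape of the tree's kernel theorem
`Summit.BirchSwinnertonDyer.BirchSwinnertonDyer.Theorems.PSRohrlichAtLevel.rohrlich_primePow_of_isNewformOf`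
(`Theorems/CyclotomicUntwistRohrlichAtLevel.lean`: ANY prime `p`, the level divisible by `p` allowed — a `Summits/`
file, fed by the consumer) and of `Rohrlich1984_nonvanishing_twists.primePow_of_isNewformOf` (`2 ∤ N`).

## Why `p = 2` needs its own file

The odd-`p` chain reads the layer `ℚ_n` inside `ℚ(μ_{p^{n+1}})` (`levelToLayer`, `Δ = μ_{p−1}`, cyclic
`(ℤ/p^{n+1})ˣ`). At `p = 2` the layer `ℚ_n = ℚ(ζ_{2^{n+2}})⁺` sits in `ℚ(μ_{2^{n+2}})` (`levelToLayerTwo`,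
`IwasawaCohomologyZetaLiftTwo`), `Δ = {±1}`, and `(ℤ/2^{n+2})ˣ = ±⟨5⟩` is not cyclic: the characters of
`Gal(ℚ_n/ℚ)` are the EVEN characters mod `2^{n+2}` (`CyclotomicZpExtensionLayerTorsionTwoProofs`,
`LayerCharacterTwoProofs`). Second difference: instead of the first-moment search for ONE character with
`R⁻_χ̄ ≠ 0` (`LayerCharacterCuspFactorProofs` §4–§5) we use Kato's OWN guarded datum (`ValueGuardSatisfiableProofs`:
`c = 1 + 12A`, `d = 1 + 12AN`, `d′ = 1` at a cusp `a/A` with `[a/A]⁻_f ≠ 0`), for which the four cusps of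
Lemma 13.10 (1) agree modulo `ℤ` and `R⁻_χ̄ = cd(c − χ̄(c))(d − χ̄(d))·[a/A]⁻_f ≠ 0` for EVERY character `χ`
(`|χ̄(c)| = 1 < c`): the exceptional characters are Rohrlich's alone (this is also what the finite-level
eigenfunctional reading of the descent sockets needs: non-vanishing off a FINITE set of characters).

## What

* §1 `cuspFactor_true_eq_of_dvd_sub_one`, `cuspFactor_true_ne_zero_of_katoDatum` — Kato's minus four-cusp factor at
  `d′ = 1`, `c ≡ 1 (A)`: `R⁻_χ̄ = [a/A]⁻·(c²d² − cd²χ̄(c) − c²dχ̄(d) + cdχ̄(cd)) = [a/A]⁻·cd(c − χ̄(c))(d − χ̄(d))`,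
  non-zero for every Dirichlet character `χ̄` when `c, d > 1` are units of the level and `[a/A]⁻ ≠ 0`;
  `exists_katoDatum` — such `(c, d, a, A)` with Kato's guards `(c, 6pA) = (d, 6pN) = 1` exist for every rational
  newform (Manin–Drinfeld: `exists_ratMinusSymbol_ne_zero`).
* §2 `charSum_eq_zero_of_levelToLayerTwo_eq_zero`, `zetaBody_depletedL_mul_cuspFactor_eq_zero_of_levelToLayerTwo_eq_zero`
  — the `p = 2` twins of `ZetaBodyLayerValuesProofs` §3: `Cor_{ℚ(μ_{2^{n+2}})/ℚ_n}(z_{n+2,∅}) = 0` forces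
  `Σ_b χ(b) ι(σ_b x_{n+2,∅}) = 0` for every character `χ` mod `2^{n+2}` killing `χ_cyc(Gal(ℚ̄/ℚ_n))` (every EVEN
  `χ`), hence `Lχ(1)·R⁻_χ̄ = 0` by the value law (C5).
* §3 `zetaBody_lift_ne_zero_of_rohrlich_two` — for a `ZetaBody W 2 f ι κ Λ c d a A z x` witness over Kato's datum
  and `y ∈ 𝐇¹_Γ(T₂W)` with `proj_n y = Cor(z_{n+2,∅})`: Rohrlich's finiteness for `f` at `2` gives `y ≠ 0`
  (a primitive EVEN character of large conductor `2^{n+2}` exists, `LayerCharacterTwo.exists_even_isPrimitive`;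
  off Rohrlich's set `L(f,χ,1) ≠ 0`, Shimura `exists_differentiable_eq_twistedLSeries_holds`, depleted
  `exists_continuation_changeLevel_of`; `R⁻_χ̄ ≠ 0` by §1 — contradiction with §2).
* §4 `exists_isEulerSystemClassTwo_ne_zero_of_rohrlich` — **hypothesis (i) of Kato Thm. 13.4 at `p = 2` in EVERY
  analytic rank**: for `W[2]` irreducible, `f` the newform of `W`, `κ` cyclotomic, every pin `I`: GRANTED
  `exists_eulerSystem_expStar_values` and Rohrlich for `f` at `2`, some `s ∈ 𝐇¹_Γ(T₂W)` has
  `IsEulerSystemClassTwo W hκ I s ∧ s ≠ 0` (the binder `hES`/`hs0` of the tree's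
  `thm13_4_two_lengthAt_fineSelmerDual_le_of_isEulerSystemClassTwo` and its consumers); corollaries
  `nontrivial_iwasawaH1_two_of_expStar_values_of_rohrlich` (`𝐇¹_Γ(T₂W) ≠ 0`) and
  `one_le_rank_iwasawaH1_two_of_expStar_values_of_rohrlich` (`1 ≤ rank_Λ 𝐇¹_Γ(T₂W)`, (12.2.2) at `p = 2`).

## Source

K. Kato, Astérisque 295 (2004) [Kato2004Asterisque]: Thm. 12.5 (1) and its proof from Thm. 12.4 [pp. 221–222] («by a
theorem of Rohrlich … `L(f, χ, r) ≠ 0` for almost all characters `χ` of `Gal(ℚ(ζ_{p^∞})/ℚ)` … hence `z_γ ≠ 0`»),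
§13.8 [p. 228], Ex. 13.3 [p. 225], Lemma 13.10 (1) [p. 230], Thm. 13.4 (i) [p. 226], Thm. 9.7 [p. 189], Thm. 6.6 (1)
[p. 163], (12.2.2) [p. 220]; D. E. Rohrlich, Invent. Math. 75 (1984) 409 / Math. Ann. 1988 / Invent. Math. 97 (1989)
(entering as `hR`) [RohrlichInventiones1984]; L. C. Washington, *Introduction to Cyclotomic Fields* §13.1 [Washington1997].
-/

set_option autoImplicit false

noncomputable section

open scoped BigOperators NumberField TensorProduct MatrixGroups
open Field IsDedekindDomain CongruenceSubgroup
open Literature.NumberTheory.GaloisRepresentations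
open Literature.NumberTheory.EllipticCurves Literature.NumberTheory.EllipticCurves.ModularForms
open Literature.NumberTheory.EllipticCurves.Kato2004.EulerSystemValues Rat.HeightOneSpectrum

namespace Literature.NumberTheory.EllipticCurves.Kato2004

/-! ## §1 Kato's own guarded datum: the minus four-cusp factor is non-zero for EVERY character -/

section KatoDatum

variable {N : ℕ} [NeZero N] (f : CuspForm (Gamma0 N) 2)

/-- **The four cusps of Lemma 13.10 (1) agree modulo `ℤ` when `d′ = 1` and `c ≡ 1 (mod A)`**, so Kato's minus
cusp factor collapses: `R⁻_χ̄(c, d, a, A, 1) = [a/A]⁻_f · (c²d² − cd²χ̄(c) − c²dχ̄(d) + cdχ̄(cd))` for ANY weight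
function `χ̄ : ℤ → ℂ` (`[x + n]⁻ = [x]⁻`, `ratMinusSymbol_add_intCast`). [cite: Kato2004Asterisque, Lemma 13.10 (1) (p. 230) and Thm. 6.6 (1) (p. 163)] -/
theorem cuspFactor_true_eq_of_dvd_sub_one (χbar : ℤ → ℂ) {c d a : ℤ} {A : ℕ} (hA : 0 < A)
    (hcA : (A : ℤ) ∣ c - 1) :
    cuspFactor f true χbar c d a A 1 =
      ((ratMinusSymbol f ((a : ℚ) / A) : ℚ) : ℂ) *
        ((c : ℂ) ^ 2 * (d : ℂ) ^ 2 - (c : ℂ) * (d : ℂ) ^ 2 * χbar c - (c : ℂ) ^ 2 * (d : ℂ) * χbar d +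
          (c : ℂ) * (d : ℂ) * χbar (c * d)) := by
  obtain ⟨k, hk⟩ := hcA
  have hAq : ((A : ℕ) : ℚ) ≠ 0 := by exact_mod_cast hA.ne'
  have hc : (c : ℚ) = 1 + (A : ℚ) * k := by
    exact_mod_cast (show c = 1 + (A : ℤ) * k by linear_combination hk)
  -- the four cusps reduce to `a/A` modulo `ℤ`
  have h2 : ((a * c : ℚ) / A) = (a : ℚ) / A + ((a * k : ℤ) : ℚ) := by
    rw [hc]; push_cast; field_simp
  have h3 : ((a * (1 : ℤ) : ℚ) / A) = (a : ℚ) / A := by rw [Int.cast_one, mul_one]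
  have h4 : ((a * c * (1 : ℤ) : ℚ) / A) = (a : ℚ) / A + ((a * k : ℤ) : ℚ) := by
    rw [Int.cast_one, mul_one]; exact h2
  have e : cuspFactor f true χbar c d a A 1 =
      ((c : ℂ) ^ 2 * (d : ℂ) ^ 2) * ((ratMinusSymbol f ((a : ℚ) / A) : ℚ) : ℂ)
        - ((c : ℂ) * (d : ℂ) ^ 2) * χbar c * ((ratMinusSymbol f ((a * c : ℚ) / A) : ℚ) : ℂ)
        - ((c : ℂ) ^ 2 * (d : ℂ)) * χbar d * ((ratMinusSymbol f ((a * (1 : ℤ) : ℚ) / A) : ℚ) : ℂ)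
        + ((c : ℂ) * (d : ℂ)) * χbar (c * d) *
            ((ratMinusSymbol f ((a * c * (1 : ℤ) : ℚ) / A) : ℚ) : ℂ) := rfl
  rw [e, h2, h3, h4, ratMinusSymbol_add_intCast]
  ring

/-- **For Kato's datum the minus cusp factor is non-zero at EVERY Dirichlet character.** With `d′ = 1`,
`c ≡ 1 (mod A)`, integers `c, d > 1` that are units of the level `M`, and `[a/A]⁻_f ≠ 0`:
`R⁻_χ̄(c,d,a,A,1) = [a/A]⁻_f · cd · (c − χ̄(c))(d − χ̄(d)) ≠ 0`, because a character value at a unit has absolute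
value `1 < c, d`. (So along Kato's guarded family only Rohrlich's finitely many characters are exceptional.)
[cite: Kato2004Asterisque, Lemma 13.10 (1) (p. 230), Lemma 13.11 (p. 231) and Thm. 12.5 (1) (p. 222)] -/
theorem cuspFactor_true_ne_zero_of_katoDatum {M : ℕ} [NeZero M] (χ : DirichletCharacter ℂ M) {c d a : ℤ}
    {A : ℕ} (hA : 0 < A) (hcA : (A : ℤ) ∣ c - 1) (hc1 : 1 < c) (hd1 : 1 < d) (hcM : IsUnit (c : ZMod M))
    (hdM : IsUnit (d : ZMod M)) (ha : ratMinusSymbol f ((a : ℚ) / A) ≠ 0) :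
    cuspFactor f true (fun k ↦ χ (k : ZMod M)) c d a A 1 ≠ 0 := by
  rw [cuspFactor_true_eq_of_dvd_sub_one f _ hA hcA]
  have hmul : χ ((c * d : ℤ) : ZMod M) = χ (c : ZMod M) * χ (d : ZMod M) := by
    rw [Int.cast_mul, map_mul]
  have hfac : (c : ℂ) ^ 2 * (d : ℂ) ^ 2 - (c : ℂ) * (d : ℂ) ^ 2 * χ (c : ZMod M) -
      (c : ℂ) ^ 2 * (d : ℂ) * χ (d : ZMod M) + (c : ℂ) * (d : ℂ) * χ ((c * d : ℤ) : ZMod M) =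
      (c : ℂ) * (d : ℂ) * (((c : ℂ) - χ (c : ZMod M)) * ((d : ℂ) - χ (d : ZMod M))) := by
    rw [hmul]; ring
  rw [hfac]
  -- `|χ(u)| = 1 < c` for a unit `u`
  have hne : ∀ {e : ℤ}, 1 < e → IsUnit (e : ZMod M) → (e : ℂ) - χ (e : ZMod M) ≠ 0 := by
    intro e he heM h0
    rw [sub_eq_zero] at h0
    have h1 : ‖χ (e : ZMod M)‖ = 1 := by
      rw [← heM.unit_spec]; exact χ.unit_norm_eq_one heM.unit
    rw [← h0, Complex.norm_intCast] at h1
    have : (1 : ℝ) < |(e : ℝ)| := by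
      rw [abs_of_pos (by exact_mod_cast (zero_lt_one.trans he))]; exact_mod_cast he
    exact absurd h1 this.ne'
  have hc0 : (c : ℂ) ≠ 0 := by exact_mod_cast (show c ≠ 0 by omega)
  have hd0 : (d : ℂ) ≠ 0 := by exact_mod_cast (show d ≠ 0 by omega)
  have hr : ((ratMinusSymbol f ((a : ℚ) / A) : ℚ) : ℂ) ≠ 0 := by exact_mod_cast ha
  exact mul_ne_zero hr (mul_ne_zero (mul_ne_zero hc0 hd0) (mul_ne_zero (hne hc1 hcM) (hne hd1 hdM)))

/-- **Kato's guarded datum exists** for every normalised rational newform `f ∈ S₂(Γ₀(N))` (`N ≠ 0`) and every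
prime `p`: `A ≥ 1` and a cusp `a/A` with `[a/A]⁻_f ≠ 0` (Manin–Drinfeld, `exists_ratMinusSymbol_ne_zero`),
`c = 1 + 6pA`, `d = 1 + 6pAN` — so `(c, 6pA) = (d, 6pN) = 1` (Ex. 13.3), `c ≡ d ≡ 1 (mod A)` (hence `dd′ ≡ 1`
with `d′ = 1`) and `c, d > 1`. [cite: Kato2004Asterisque, Ex. 13.3 (p. 225) and 13.9 (p. 229)] -/
theorem exists_katoDatum (hf : IsNewform0 f) (hQ : coeffField f = ⊥) (p : ℕ) [hp : Fact p.Prime] :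
    ∃ (c d a : ℤ) (A : ℕ), 0 < A ∧ Int.gcd c (6 * p * A) = 1 ∧ Int.gcd d (6 * p * N) = 1 ∧
      (A : ℤ) ∣ c - 1 ∧ (A : ℤ) ∣ d - 1 ∧ 1 < c ∧ 1 < d ∧ ratMinusSymbol f ((a : ℚ) / A) ≠ 0 := by
  obtain ⟨r, hr⟩ := exists_ratMinusSymbol_ne_zero f hf hQ
  have hp1 : 1 ≤ (p : ℤ) := by exact_mod_cast hp.out.one_lt.le
  have hA1 : 1 ≤ (r.den : ℤ) := by exact_mod_cast r.den_pos
  have hN1 : 1 ≤ (N : ℤ) := by exact_mod_cast Nat.pos_of_ne_zero (NeZero.ne N)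
  have hpos₁ : (0 : ℤ) < 6 * p * r.den := by positivity
  have hpos₂ : (0 : ℤ) < 6 * p * r.den * N := by positivity
  refine ⟨1 + 6 * p * r.den, 1 + 6 * p * r.den * N, r.num, r.den, r.den_pos, ?_, ?_, ?_, ?_, ?_, ?_, ?_⟩
  · rw [← Int.isCoprime_iff_gcd_eq_one]; exact ⟨1, -1, by ring⟩
  · rw [← Int.isCoprime_iff_gcd_eq_one]; exact ⟨1, -(r.den : ℤ), by ring⟩
  · exact ⟨6 * p, by ring⟩
  · exact ⟨6 * p * N, by ring⟩
  · linarith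
  · linarith
  · rwa [Rat.num_div_den]

end KatoDatum

/-! ## §2 Layer-vanishing ⇒ value-vanishing at `p = 2` (the layer `ℚ_n` inside `ℚ(μ_{2^{n+2}})`) -/

section LayerValues

variable {W : WeierstrassCurve ℚ} [W.IsElliptic] [ContinuousSMul ℤ_[2] (W.tateModule 2)]
  [Module.Free ℤ_[2] (W.tateModule 2)] [Module.Finite ℤ_[2] (W.tateModule 2)] {N : ℕ}
  {f : CuspForm (Gamma0 N) 2} {ι : (m : ℕ) → (CyclotomicField m ℚ →+* ℂ)} {κ' : ℝ}
  {Λ' : ∀ (k : ℕ) (r : Finset (HeightOneSpectrum (𝓞 ℚ))),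
    H1 (tateRep W 2) (cycSubgroup 2 k r) →ₗ[ℤ_[2]] ℚ_[2] ⊗[ℚ] CyclotomicField (cycLevel 2 k r) ℚ}
  {c d a : ℤ} {A : ℕ}
  {z : ∀ (k : ℕ) (r : (cyclotomicLevelsRat 2 (badPlaces c d A N)).Ideals),
    H1 (tateRep W 2) ((cyclotomicLevelsRat 2 (badPlaces c d A N)).level k r.1)}
  {x : ∀ (k : ℕ) (r : (cyclotomicLevelsRat 2 (badPlaces c d A N)).Ideals),
    CyclotomicField (cycLevel 2 k r.1) ℚ}
  {K : ZpExtension ℚ 2}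

/-- **Layer-vanishing ⇒ the character sums of `x_{n+2,∅}` vanish on the characters of `Gal(ℚ_n/ℚ)`** (`p = 2`):
if `Cor_{ℚ(μ_{2^{n+2}})/ℚ_n}(z_{n+2,∅}) = 0` (`levelToLayerTwo`, `K` cyclotomic) then
`Σ_b χ(b) ι(σ_b x_{n+2,∅}) = 0` for every Dirichlet character `χ` mod `2^{n+2}` killing `χ_cyc(Gal(ℚ̄/ℚ_n))` —
`res ∘ cor = Σ conj` over `Gal(ℚ(μ_{2^{n+2}})/ℚ_n) = {±1}`, (C3a), (C4) and `y ↦ 1 ⊗ y` injective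
(`charSum_eq_zero_of_coresLe_eq_zero`). [cite: Kato2004Asterisque, §13.8 (p. 228), Thm. 12.5 (1) (pp. 221–222)] [cite: Washington1997, §13.1] -/
theorem charSum_eq_zero_of_levelToLayerTwo_eq_zero (hbody : ZetaBody W 2 f ι κ' Λ' c d a A z x)
    (hK : K.IsCyclotomic) (n : ℕ)
    (h0 : levelToLayerTwo W hK (badPlaces c d A N) n
      (z (n + 2) (cyclotomicLevelsRat 2 (badPlaces c d A N)).idealOne) = 0)
    (χ : DirichletCharacter ℂ (cycLevel 2 (n + 2) ∅))
    (hχ : ∀ σ ∈ K.layerSubgroup n,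
      χ ((modNCyclotomicCharacter ℚ (cycLevel 2 (n + 2) ∅) σ : (ZMod (cycLevel 2 (n + 2) ∅))ˣ) :
        ZMod (cycLevel 2 (n + 2) ∅)) = 1) :
    charSum (cycLevel 2 (n + 2) ∅) (ι (cycLevel 2 (n + 2) ∅)) χ
      (x (n + 2) (cyclotomicLevelsRat 2 (badPlaces c d A N)).idealOne) = 0 := by
  have hle : cycSubgroup 2 (n + 2) ∅ ≤ K.layerSubgroup n :=
    hK.cyclotomicLevelsRat_level_le_layerSubgroup_two (badPlaces c d A N) n
  letI : Fintype (K.layerSubgroup n ⧸ (cycSubgroup 2 (n + 2) ∅).subgroupOf (K.layerSubgroup n)) :=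
    Fintype.ofFinite _
  obtain ⟨-, -, hC3a, -, hC4, -⟩ := hbody
  have hξ : Λ' (n + 2) ∅ (z (n + 2) (cyclotomicLevelsRat 2 (badPlaces c d A N)).idealOne) =
      (1 : ℚ_[2]) ⊗ₜ[ℚ] (x (n + 2) (cyclotomicLevelsRat 2 (badPlaces c d A N)).idealOne :
        CyclotomicField (cycLevel 2 (n + 2) ∅) ℚ) :=
    hC4 (n + 2) (cyclotomicLevelsRat 2 (badPlaces c d A N)).idealOne
  have h0' : coresLe (tateRep W 2).toTopRep hle ((cyclotomicLevelsRat 2 ∅).isOpen_level (n + 2) ∅)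
      (z (n + 2) (cyclotomicLevelsRat 2 (badPlaces c d A N)).idealOne :
        H1 (tateRep W 2) (cycSubgroup 2 (n + 2) ∅)) = 0 := by
    unfold levelToLayerTwo at h0
    exact h0
  exact charSum_eq_zero_of_coresLe_eq_zero (n + 2) ∅ hle (Λ' (n + 2) ∅) (hC3a (n + 2) ∅) hξ h0'
    (ι (cycLevel 2 (n + 2) ∅)) χ hχ

/-- **Layer-vanishing ⇒ `Lχ(1) · R⁻_χ̄ = 0`** (`p = 2`): under the hypotheses of
`charSum_eq_zero_of_levelToLayerTwo_eq_zero`, for `f` the newform of `W` (`Ω⁺_f > 0`), `κ ≠ 0`, every EVEN such `χ`,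
every `d′` with `dd′ ≡ 1 (A)`, `(cd, 2^{n+2}A) = 1`, and every entire continuation `Lχ` of the `(2A·2^{n+2})`-depleted
twisted series: `Lχ(1) · R⁻_χ̄(c,d,a,A,d′) = 0` (value law (C5)).
[cite: Kato2004Asterisque, Thm. 9.7 (p. 189), Thm. 6.6 (1) (p. 163), Thm. 12.5 (1) (pp. 221–222)] -/
theorem zetaBody_depletedL_mul_cuspFactor_eq_zero_of_levelToLayerTwo_eq_zero [NeZero N]
    (hbody : ZetaBody W 2 f ι κ' Λ' c d a A z x) (hf : IsNewformOf W f) (hκ' : κ' ≠ 0)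
    (hK : K.IsCyclotomic) (n : ℕ)
    (h0 : levelToLayerTwo W hK (badPlaces c d A N) n
      (z (n + 2) (cyclotomicLevelsRat 2 (badPlaces c d A N)).idealOne) = 0)
    (χ : DirichletCharacter ℂ (cycLevel 2 (n + 2) ∅))
    (hχ : ∀ σ ∈ K.layerSubgroup n,
      χ ((modNCyclotomicCharacter ℚ (cycLevel 2 (n + 2) ∅) σ : (ZMod (cycLevel 2 (n + 2) ∅))ˣ) :
        ZMod (cycLevel 2 (n + 2) ∅)) = 1)
    (heven : χ (-1) = 1) (d' : ℤ) (hcd : Int.gcd (c * d) (cycLevel 2 (n + 2) ∅ * A) = 1)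
    (hdd' : d * d' ≡ 1 [ZMOD (A : ℤ)]) {Lχ : ℂ → ℂ}
    (hLχ : IsDepletedTwistedL f (cycLevel 2 (n + 2) ∅) (2 * A) χ Lχ) :
    Lχ 1 * cuspFactor f true (fun k ↦ χ⁻¹ (k : ZMod (cycLevel 2 (n + 2) ∅))) c d a A d' = 0 := by
  have h5 := ((hbody.2.2.2.2.2) (n + 2) (cyclotomicLevelsRat 2 (badPlaces c d A N)).idealOne d' χ Lχ hcd
    hdd' hLχ).1 heven
  have hcs : charSum (cycLevel 2 (n + 2) (cyclotomicLevelsRat 2 (badPlaces c d A N)).idealOne.1)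
      (ι (cycLevel 2 (n + 2) (cyclotomicLevelsRat 2 (badPlaces c d A N)).idealOne.1)) χ
      (x (n + 2) (cyclotomicLevelsRat 2 (badPlaces c d A N)).idealOne) = 0 :=
    charSum_eq_zero_of_levelToLayerTwo_eq_zero hbody hK n h0 χ hχ
  rw [hcs] at h5
  have hΩ : (plusPeriod f : ℂ) ≠ 0 := by
    exact_mod_cast (IsNewform0.plusPeriod_pos_holds hf.1 hf.coeffField_eq_bot).ne'
  have hκ : (κ' : ℂ) ≠ 0 := by exact_mod_cast hκ'
  have h := h5.symm
  rw [mul_assoc, mul_eq_zero] at h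
  rcases h with h | h
  · exact absurd h hκ
  · rw [div_mul_eq_mul_div, div_eq_zero_iff] at h
    exact h.resolve_right hΩ

end LayerValues

/-! ## §3 The Λ-adic lift of Kato's family at `p = 2` is non-zero, given Rohrlich -/

section Lift

variable {W : WeierstrassCurve ℚ} [W.IsElliptic] [ContinuousSMul ℤ_[2] (W.tateModule 2)]
  [Module.Free ℤ_[2] (W.tateModule 2)] [Module.Finite ℤ_[2] (W.tateModule 2)] {N : ℕ} [NeZero N]
  {f : CuspForm (Gamma0 N) 2} {ι : (m : ℕ) → (CyclotomicField m ℚ →+* ℂ)} {κ' : ℝ}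
  {Λ' : ∀ (k : ℕ) (r : Finset (HeightOneSpectrum (𝓞 ℚ))),
    H1 (tateRep W 2) (cycSubgroup 2 k r) →ₗ[ℤ_[2]] ℚ_[2] ⊗[ℚ] CyclotomicField (cycLevel 2 k r) ℚ}
  {c d a : ℤ} {A : ℕ}
  {z : ∀ (k : ℕ) (r : (cyclotomicLevelsRat 2 (badPlaces c d A N)).Ideals),
    H1 (tateRep W 2) ((cyclotomicLevelsRat 2 (badPlaces c d A N)).level k r.1)}
  {x : ∀ (k : ℕ) (r : (cyclotomicLevelsRat 2 (badPlaces c d A N)).Ideals),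
    CyclotomicField (cycLevel 2 k r.1) ℚ}
  {K : ZpExtension ℚ 2} {γ : absoluteGaloisGroup ℚ} {I : IwasawaH1Data W 2 K γ}

/-- An integer coprime to `2` is a unit modulo `2^{n+2}` (the guards `(c, 12A) = (d, 12N) = 1` make `c, d` odd).
[cite: Kato2004Asterisque, (8.1.2) (p. 180) and Ex. 13.3 (p. 225)] -/
theorem isUnit_intCast_zmod_of_gcd_eq_one {e : ℤ} {B : ℕ} (he : Int.gcd e (6 * 2 * B) = 1) (n : ℕ) {M : ℕ}
    (hM : M = 2 ^ (n + 2)) : IsUnit (e : ZMod M) := by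
  subst hM
  rw [ZMod.coe_int_isUnit_iff_isCoprime]
  have h2 : IsCoprime e (2 : ℤ) :=
    ((Int.isCoprime_iff_gcd_eq_one.mpr he).of_mul_right_left).of_mul_right_right
  have h3 : IsCoprime ((2 : ℤ) ^ (n + 2)) e := (h2.pow_right (n := n + 2)).symm
  exact_mod_cast h3

/-- **The Λ-adic lift of Kato's guarded family is NON-ZERO at `p = 2`, given Rohrlich's theorem for `f` at `2`**
— in EVERY analytic rank. Data: a `ZetaBody W 2 f ι κ Λ c d a A z x` witness with `κ ≠ 0` for `f` the newform of
`W`, over Kato's datum (`A ≥ 1`, `(c, 12A) = (d, 12N) = 1`, `c ≡ d ≡ 1 (mod A)`, `c, d > 1`, `[a/A]⁻_f ≠ 0`); `K` a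
cyclotomic `ℤ₂`-extension and `y ∈ 𝐇¹_Γ(T₂W)` with `proj_n y = Cor_{ℚ(μ_{2^{n+2}})/ℚ_n}(z_{n+2,∅})`. If only
finitely many primitive characters of `2`-power conductor have an entire continuation of `L(f,χ,s)` vanishing at `1`
(`hR`), then `y ≠ 0`: otherwise every layer vanishes and `Lχ(1)·R⁻_χ̄ = 0` for every even `χ` mod `2^{n+2}` (§2),
contradicting a primitive even `χ` of large conductor (`LayerCharacterTwo.exists_even_isPrimitive`) off Rohrlich's
set, for which `Lχ(1) ≠ 0` (`exists_differentiable_eq_twistedLSeries_holds`, `exists_continuation_changeLevel_of`)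
and `R⁻_χ̄ ≠ 0` (§1). Kato's step «`L(f,χ,1) ≠ 0` for almost all `χ` ⇒ `z_γ ≠ 0`» of the proof of Thm. 12.5 (1),
at `p = 2`. [cite: Kato2004Asterisque, Thm. 12.5 (1) and proof (pp. 221–222), §13.8 (p. 228)] [cite: Washington1997, §13.1] -/
theorem zetaBody_lift_ne_zero_of_rohrlich_two (hbody : ZetaBody W 2 f ι κ' Λ' c d a A z x)
    (hf : IsNewformOf W f) (hκ' : κ' ≠ 0) (hA : 0 < A) (hc : Int.gcd c (6 * 2 * A) = 1)
    (hd : Int.gcd d (6 * 2 * N) = 1) (hcA : (A : ℤ) ∣ c - 1) (hdA : (A : ℤ) ∣ d - 1) (hc1 : 1 < c)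
    (hd1 : 1 < d) (ha : ratMinusSymbol f ((a : ℚ) / A) ≠ 0) (hK : K.IsCyclotomic) {y : I.H}
    (hy : ∀ n : ℕ, I.proj n y = levelToLayerTwo W hK (badPlaces c d A N) n
      (z (n + 2) (cyclotomicLevelsRat 2 (badPlaces c d A N)).idealOne))
    (hR : Set.Finite {χ : Σ m : ℕ, DirichletCharacter ℂ m |
        χ.1 ≠ 0 ∧ χ.1.primeFactors ⊆ {2} ∧ χ.2.IsPrimitive ∧
          ∃ L : ℂ → ℂ, Differentiable ℂ L ∧
            (∀ s : ℂ, 2 < s.re → L s = twistedLSeries f χ.2 s) ∧ L 1 = 0}) :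
    y ≠ 0 := by
  intro hy0
  have hdd' : d * 1 ≡ 1 [ZMOD (A : ℤ)] := by
    rw [mul_one, Int.modEq_iff_dvd]
    obtain ⟨k, hk⟩ := hdA
    exact ⟨-k, by linear_combination -hk⟩
  -- Rohrlich: the exceptional levels are bounded by some `B`; the level `M = 2^{n+2}`, `n = B + 1`
  obtain ⟨B, hB⟩ := (hR.image Sigma.fst).bddAbove
  have h1n : 1 ≤ B + 1 := by omega
  have hBn : B < 2 ^ (B + 1 + 2) := lt_of_lt_of_le (by omega) (Nat.lt_pow_self one_lt_two).le
  have hM : cycLevel 2 (B + 1 + 2) ∅ = 2 ^ (B + 1 + 2) := by simp [cycLevel]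
  -- a primitive EVEN character of conductor `2^{n+2}`
  have hη : IsPrimitiveRoot (Complex.exp (2 * Real.pi * Complex.I / (2 ^ (B + 1) : ℕ))) (2 ^ (B + 1)) :=
    Complex.isPrimitiveRoot_exp (2 ^ (B + 1)) (pow_ne_zero _ two_ne_zero)
  obtain ⟨χ, heven, hprim⟩ :=
    LayerCharacterTwo.exists_even_isPrimitive (S := ℂ) h1n (M := cycLevel 2 (B + 1 + 2) ∅) hM hη
  have hlayer : ∀ σ ∈ K.layerSubgroup (B + 1),
      χ ((modNCyclotomicCharacter ℚ (cycLevel 2 (B + 1 + 2) ∅) σ :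
          (ZMod (cycLevel 2 (B + 1 + 2) ∅))ˣ) : ZMod (cycLevel 2 (B + 1 + 2) ∅)) = 1 :=
    fun σ hσ ↦ hK.dirichletCharacter_apply_eq_one_of_mem_layerSubgroup_two (B + 1) hM χ heven hσ
  -- Shimura: an entire continuation `L₀` of `L(f, χ, s)`; Rohrlich off the exceptional levels: `L₀ 1 ≠ 0`
  obtain ⟨L₀, hL₀d, hL₀s⟩ :=
    exists_differentiable_eq_twistedLSeries_holds f (m := cycLevel 2 (B + 1 + 2) ∅) χ
  have hL₀1 : L₀ 1 ≠ 0 := by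
    intro h0
    have hle : cycLevel 2 (B + 1 + 2) ∅ ≤ B := by
      refine hB ⟨⟨cycLevel 2 (B + 1 + 2) ∅, χ⟩, ?_, rfl⟩
      refine ⟨NeZero.ne _, ?_, hprim, L₀, hL₀d, hL₀s, h0⟩
      change (cycLevel 2 (B + 1 + 2) ∅).primeFactors ⊆ {2}
      rw [hM, Nat.primeFactors_prime_pow (Nat.succ_ne_zero _) Nat.prime_two]
    rw [hM] at hle
    exact absurd hle (not_le.mpr hBn)
  -- the depleted continuation at level `2^{n+2}·(2A)` does not vanish at `1`
  haveI : NeZero (cycLevel 2 (B + 1 + 2) ∅ * (2 * A)) :=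
    ⟨mul_ne_zero (NeZero.ne _) (mul_ne_zero two_ne_zero hA.ne')⟩
  obtain ⟨L, hLd, hLs, hL1⟩ := exists_continuation_changeLevel_of hf
    (dvd_mul_right (cycLevel 2 (B + 1 + 2) ∅) (2 * A)) χ ⟨L₀, hL₀d, hL₀s, hL₀1⟩
  have hdep : IsDepletedTwistedL f (cycLevel 2 (B + 1 + 2) ∅) (2 * A) χ L := ⟨hLd, hLs⟩
  -- `R⁻_{χ⁻¹} ≠ 0` for Kato's datum
  have hcusp : cuspFactor f true (fun k ↦ χ⁻¹ (k : ZMod (cycLevel 2 (B + 1 + 2) ∅))) c d a A 1 ≠ 0 :=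
    cuspFactor_true_ne_zero_of_katoDatum f χ⁻¹ hA hcA hc1 hd1
      (isUnit_intCast_zmod_of_gcd_eq_one hc (B + 1) hM) (isUnit_intCast_zmod_of_gcd_eq_one hd (B + 1) hM) ha
  -- but every layer of `y = 0` vanishes, so the value law gives `L(1) · R⁻_χ̄ = 0`
  have h0 : levelToLayerTwo W hK (badPlaces c d A N) (B + 1)
      (z (B + 1 + 2) (cyclotomicLevelsRat 2 (badPlaces c d A N)).idealOne) = 0 := by
    rw [← hy (B + 1), hy0, map_zero]
  exact mul_ne_zero hL1 hcusp
    (zetaBody_depletedL_mul_cuspFactor_eq_zero_of_levelToLayerTwo_eq_zero hbody hf hκ' hK (B + 1) h0 χ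
      hlayer heven 1 (gcd_mul_cycLevel_mul_eq_one_of_guards hc hd hdd' (B + 1 + 1)) hdd' hdep)

end Lift

/-! ## §4 Assembly: hypothesis (i) of Thm. 13.4 at `p = 2` in every analytic rank, modulo the construction fact
and Rohrlich -/

section Assembly

variable (W : WeierstrassCurve ℚ) [W.IsElliptic] [ContinuousSMul ℤ_[2] (W.tateModule 2)]
  [Module.Free ℤ_[2] (W.tateModule 2)] [Module.Finite ℤ_[2] (W.tateModule 2)] {κ : ZpExtension ℚ 2}
  {γ : absoluteGaloisGroup ℚ} (I : IwasawaH1Data W 2 κ γ)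

/-- **Hypothesis (i) of Kato Thm. 13.4 at `p = 2`, in EVERY analytic rank, modulo the construction fact and
Rohrlich.** For every elliptic `W/ℚ` with `W[2]` irreducible, every newform `f` of `W`, every cyclotomic
`ℤ₂`-extension `κ` and every pinned `I : IwasawaH1Data W 2 κ γ`: GRANTED `exists_eulerSystem_expStar_values`
(Kato (8.1.3)/Ex. 13.3 with Thm. 9.7 and Thm. 6.6 (1); no parity hypothesis) and Rohrlich's finiteness for `f` at
`2` (hypothesis `hR`, the shape of `PSRohrlichAtLevel.rohrlich_primePow_of_isNewformOf`), there is
`s ∈ 𝐇¹_Γ(T₂W)` with `IsEulerSystemClassTwo W hκ I s` and `s ≠ 0`: Kato's guarded datum (`exists_katoDatum`), the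
lift of its zeta family (`exists_isEulerSystemClassTwo_of_zetaBody`) and §3. This is the binder «a non-zero
genuine `2`-adic Euler-system class» of the tree's Thm. 13.4 (2) at `p = 2`
(`thm13_4_two_lengthAt_fineSelmerDual_le_of_isEulerSystemClassTwo` and its consumers).
[cite: Kato2004Asterisque, Ex. 13.3 (p. 225), Thm. 12.5 (1) (pp. 221–222), Thm. 13.4 (p. 226), 13.9 (p. 229)] -/
theorem exists_isEulerSystemClassTwo_ne_zero_of_rohrlich (hκ : κ.IsCyclotomic)
    (hES : exists_eulerSystem_expStar_values) (hirr : W.HasIrreducibleModPGaloisRep 2) {N : ℕ} [NeZero N]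
    (f : CuspForm (Gamma0 N) 2) (hf : IsNewformOf W f)
    (hR : Set.Finite {χ : Σ m : ℕ, DirichletCharacter ℂ m |
        χ.1 ≠ 0 ∧ χ.1.primeFactors ⊆ {2} ∧ χ.2.IsPrimitive ∧
          ∃ L : ℂ → ℂ, Differentiable ℂ L ∧
            (∀ s : ℂ, 2 < s.re → L s = twistedLSeries f χ.2 s) ∧ L 1 = 0}) :
    ∃ s : I.H, IsEulerSystemClassTwo W hκ I s ∧ s ≠ 0 := by
  set ι : (m : ℕ) → (CyclotomicField m ℚ →+* ℂ) :=
    fun m ↦ Classical.choice (inferInstance : Nonempty (CyclotomicField m ℚ →+* ℂ)) with hι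
  obtain ⟨κ', hκ'0, Λ', hfam⟩ := hES W 2 hirr f hf ι
  obtain ⟨c, d, a, A, hA, hc, hd, hcA, hdA, hc1, hd1, ha⟩ := exists_katoDatum f hf.1 hf.coeffField_eq_bot 2
  obtain ⟨z, x, hbody⟩ := hfam c d a A hA hc hd
  have hne := two_mul_natAbs_ne_zero_of_guards 2 hA (NeZero.ne N) hc hd
  obtain ⟨y, hyES, hy⟩ := exists_isEulerSystemClassTwo_of_zetaBody W hκ I f ι κ' Λ' c d a A z x hbody hne
  exact ⟨y, hyES, zetaBody_lift_ne_zero_of_rohrlich_two hbody hf hκ'0 hA hc hd hcA hdA hc1 hd1 ha hκ hy hR⟩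

/-- **`𝐇¹_Γ(T₂W) ≠ 0` in every analytic rank** (`W[2]` irreducible, `f` the newform of `W`, `κ` cyclotomic, any
pin `I`), modulo `exists_eulerSystem_expStar_values` and Rohrlich for `f` at `2` — the «`Z_q ≠ 0`» of Kato
Prop. 13.7 / the non-vanishing half of Thm. 12.5 (1), at `p = 2`.
[cite: Kato2004Asterisque, Thm. 12.5 (1) (pp. 221–222), Prop. 13.7 (p. 227)] -/
theorem nontrivial_iwasawaH1_two_of_expStar_values_of_rohrlich (hκ : κ.IsCyclotomic)
    (hES : exists_eulerSystem_expStar_values) (hirr : W.HasIrreducibleModPGaloisRep 2) {N : ℕ} [NeZero N]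
    (f : CuspForm (Gamma0 N) 2) (hf : IsNewformOf W f)
    (hR : Set.Finite {χ : Σ m : ℕ, DirichletCharacter ℂ m |
        χ.1 ≠ 0 ∧ χ.1.primeFactors ⊆ {2} ∧ χ.2.IsPrimitive ∧
          ∃ L : ℂ → ℂ, Differentiable ℂ L ∧
            (∀ s : ℂ, 2 < s.re → L s = twistedLSeries f χ.2 s) ∧ L 1 = 0}) :
    Nontrivial I.H := by
  obtain ⟨s, -, hs⟩ := exists_isEulerSystemClassTwo_ne_zero_of_rohrlich W I hκ hES hirr f hf hR
  exact nontrivial_of_ne s 0 hs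

/-- **`1 ≤ rank_Λ 𝐇¹_Γ(T₂W)` in every analytic rank** — the statement of the named fact
`Kato2004.one_le_rank_iwasawaH1` ((12.2.2)) at `p = 2` with `W[2]` irreducible, for `κ` cyclotomic with a
topological generator `γ` and any pin `I`, modulo `exists_eulerSystem_expStar_values`, a newform `f` of `W` and
Rohrlich for `f` at `2` (`𝐇¹` is `Λ`-torsion free: `IwasawaH1Data.isTorsionFree`).
[cite: Kato2004Asterisque, §12.2 (12.2.2) (p. 220), Thm. 12.4 (2) (p. 221), Thm. 12.5 (1) (pp. 221–222)] -/
theorem one_le_rank_iwasawaH1_two_of_expStar_values_of_rohrlich (hκ : κ.IsCyclotomic)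
    (hγ : κ.IsTopGenerator γ) (hES : exists_eulerSystem_expStar_values) (hirr : W.HasIrreducibleModPGaloisRep 2) {N : ℕ} [NeZero N]
    (f : CuspForm (Gamma0 N) 2) (hf : IsNewformOf W f)
    (hR : Set.Finite {χ : Σ m : ℕ, DirichletCharacter ℂ m |
        χ.1 ≠ 0 ∧ χ.1.primeFactors ⊆ {2} ∧ χ.2.IsPrimitive ∧
          ∃ L : ℂ → ℂ, Differentiable ℂ L ∧
            (∀ s : ℂ, 2 < s.re → L s = twistedLSeries f χ.2 s) ∧ L 1 = 0}) :
    1 ≤ Module.rank (IwasawaAlgebra 2) I.H := by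
  haveI := nontrivial_iwasawaH1_two_of_expStar_values_of_rohrlich W I hκ hES hirr f hf hR
  exact one_le_rank_iwasawaH1_of_nontrivial hγ I

/-- **Rohrlich DISCHARGED in `Literature` when `2 ∤ N`**: the tree's kernel theorem
`Rohrlich1984_nonvanishing_twists.primePow_of_isNewformOf` supplies `hR`, so a non-zero genuine `2`-adic
Euler-system class exists in every pinned `𝐇¹_Γ(T₂W)` modulo the construction fact and a newform alone (`W[2]`
irreducible; `2 ∣ N` — additive or multiplicative `2` — is served on the Summits side by
`PSRohrlichAtLevel.rohrlich_primePow_of_isNewformOf`). [cite: RohrlichInventiones1984, Theorem (p. 409)]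
[cite: Kato2004Asterisque, Thm. 12.5 (1) (pp. 221–222)] -/
theorem exists_isEulerSystemClassTwo_ne_zero_of_not_two_dvd_level (hκ : κ.IsCyclotomic)
    (hES : exists_eulerSystem_expStar_values) (hirr : W.HasIrreducibleModPGaloisRep 2) {N : ℕ} [NeZero N]
    (f : CuspForm (Gamma0 N) 2) (hf : IsNewformOf W f) (hN : ¬ 2 ∣ N) :
    ∃ s : I.H, IsEulerSystemClassTwo W hκ I s ∧ s ≠ 0 :=
  haveI : Fact (Nat.Prime 2) := ⟨Nat.prime_two⟩
  exists_isEulerSystemClassTwo_ne_zero_of_rohrlich W I hκ hES hirr f hf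
    (Rohrlich1984_nonvanishing_twists.primePow_of_isNewformOf hf hN)

end Assembly

end Literature.NumberTheory.EllipticCurves.Kato2004

end
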